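import Literature.NumberTheory.EllipticCurves.SteinWuthrich2013.MultiplicativeLeadingTerm
import Literature.NumberTheory.EllipticCurves.Skinner2016.MultiplicativeMainConjecture
import Literature.NumberTheory.EllipticCurves.BSDRootNumberSmallConductorProofs
import HarnessLib

/-!
# Disegni 2020, Theorem 1 at a prime `p ‖ N` in analytic rank one: the `p`-adic Birch–Swinnerton-Dyer
# formula RELATIVE to the classical one (Mazur–Tate–Teitelbaum's formula against `#Ш_an`) — named fact (a THEOREM in print)

Topic `Literature/NumberTheory/EllipticCurves` (cluster `Disegni2020`). ONE named fact (two clauses,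
nothing asserted) and bookkeeping projections; no other content. HONEST FRAMING (BSD rank-`≤ 1`
residual cell `b2b-bsdres`, lane CLASS-CLOSURE, seat `cc-typer-3`, class N8/O2 = X11b): the cell
deletes the COMBINATION-SHAPED residual classes of the rank-`≤ 1` BSD formula STRICTLY from published
theorems and TYPES the remainder; this file supplies the PUBLISHED analytic leading-term input of the
`p`-adic lever at a multiplicative prime in analytic rank ONE (the rank-`0` analogue is the
interpolation property itself, `L_p(E,0) = (1 - α⁻¹)·L(E,1)/Ω`, resp. Greenberg–Stevens); it is not
a class theorem and nothing here is "finishing BSD".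

Source (held: `paper:arxiv-1609.02528`, corpus-tex chunks `p0001 … p0023`): D. Disegni, *On the
`p`-adic Birch and Swinnerton-Dyer conjecture for elliptic curves over number fields*, Kyoto J. Math.
60 (2020), no. 2, 473–510, doi:10.1215/21562261-2018-0012 (bib key `Disegni2020`). Theorem numbers
below are those of the arXiv text (Thm. 1 of §1.2 "Evidence" = Thm. 4 of §3.2, where it is proved);
chunk/line locators refer to the held copy.

**The statement (BSD_p), as printed** (the paper's relative `p`-adic BSD formula) (§1.1.4 [p0005 L14–L38]). For `A/K` an elliptic curve with
ordinary reduction at all `𝔭 ∣ p`, `Γ` a `ℤ_p`-free quotient of `Gal(K^{ab}/K)`, granted Hypothesis (`L_p`) (existence of the `p`-adic `L`-function `L_p^{(Γ)}(A) ∈ 𝒪_L⟦Γ⟧ ⊗ L` with the interpolation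
property of §1.1.1 [p0003 L27–L50]: `L_p(A)(χ) = ∏_{𝔭∣p} e_𝔭(χ_𝔭) · L(A,χ,1)/(|D_K|^{-1/2} Ω_A)`,
`Ω_A` "the Néron period appearing in the Birch and Swinnerton-Dyer conjecture for `A` [tate-bsd]",
`e_𝔭(𝟙) = (1 - α_𝔭)(1 - α'_𝔭)` with `α_𝔭 = +1` (split) / `-1` (non-split) and `α'_𝔭 = 0` at a
multiplicative `𝔭` [p0003 L23, L47]) and Hypothesis (BSD_∞)(1)–(2) (`rank A(K) = ord_{s=1} L(A,s) = r`
and `|Ш(A)|_an := L^{(r)}(A,1)/(r!·|D_K|^{-1/2}·R_NT(A)·Ω_A·∏_v c_v(A)) ∈ ℚ^×` [p0005 L2–L10]):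
with `r̃ = r + #S_p^{exc}` (`S_p^{exc}` = primes above `p` of SPLIT multiplicative reduction),
`ẽ_𝔭(𝟙) = e_𝔭(𝟙)` off `S_p^{exc}` and `= ord_𝔭(q_{A,𝔭})⁻¹` on it, "`L_p^{(Γ)}(A)` vanishes at
`χ = 𝟙` to order at least `r̃` … and
`d^{r̃} L_p^{(Γ)}(A, 𝟙) = ∏_{𝔭∣p} ẽ_𝔭(𝟙) · R̃_ℓ(A) · |Ш(A)|_an · ∏_v c_v(A)` in `Sym^{r̃} Γ ⊗ L`",
`R̃_ℓ(A)` the discriminant of the (extended) `p`-adic height pairing, where (Def. 1 [p0008 L56–L60])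
"`R(M,h) := [M : Σ ℤ x_i]^{-2} · det h(x_i,x_j)`" — so the regulators `R_NT`, `R̃_ℓ` "account for
`|A(K)_tors|²`" [p0004 L55]. Equivalent form (Prop. 2 [p0011 L14–L26], "already given in [mtt]"):
`d^{r̃} L_p = ∏_{𝔭 ∉ exc} e_𝔭(𝟙) · ∏_{𝔭 ∈ exc} 𝓛_𝔭(A) · R^{norm}(A) · L*_alg(A,1)` with
`L*_alg(A,1) = L^{(r)}(A,1)/(r!·|D_K|^{-1/2}·Ω_A·R_NT(A))` and `R^{norm}` the regulator of the
NORM-ADAPTED height `h^{norm}(x,y) = h_ℓ(x,y) - Σ_{𝔭 ∈ exc} log_{A,𝔭}(x) log_{A,𝔭}(y)/ℓ(q_{A,𝔭})`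
("following Schneider" [p0008 L40–L44]).

**Theorem 1, as printed** (§1.2 [p0005 L51–L57]; = Thm. 4, §3.2 [p0011 L64–L74]): "Let `E/ℚ` be
an elliptic curve of conductor `N` with ordinary reduction at the prime `p`. Suppose that
`r_an := ord_{s=1} L(E,s) ≤ 1` and that (∗) if `r_an = 1` and `S_p^{exc}(E) ≠ ∅`, then `p ≥ 5` and
there exists another prime `m ≠ p` of multiplicative reduction for `E`. Then Hypotheses (`L_p`) and
(BSD_∞)(1)–(2) are satisfied, and [(BSD_p)] holds." Thm. 4: "• If the reduction of `E` at
`p` is not split multiplicative or `r = 0`, then [(BSD_p)] holds. • If `r = 1` and the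
reduction of `E` at `p` is split multiplicative, suppose that `p ≥ 5`. Then [(BSD_p)] holds
up to a nonzero rational number; if moreover there is at least another prime `m ≠ p` of
multiplicative reduction for `E`, then [(BSD_p)] holds exactly, that is
`d² L_p(E,𝟙) = 𝓛_p(E) · R^{norm}(E) · L'_alg(E,1)` in `Γ_ℚ^{⊗2} ⊗ ℚ`." Proof for `r = 1`
non-split [p0012 L1–L6]: the author's `p`-adic Gross–Zagier formula (Compositio Math. 153 (2017)
Thm. B, held `paper:arxiv-1510.02114`, stated for "potentially 𝔭-ordinary good or semistable
reduction" with NO restriction on the rational prime `p` [its p0005 L6, p0008 L11]) compared with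
Yuan–Zhang–Zhang over a Heegner field `K` (all `ℓ ∣ N` split, `L(E^{(K)},1) ≠ 0`, Murty–Murty) —
"This argument was of course already made by Perrin-Riou [PR] when `E` has good reduction"; for
`r = 1` split [p0012 L14–L18]: Venerucci's exceptional-zero formula, made exact via an auxiliary
multiplicative prime `m`. The `p`-adic `L`-function of Hypothesis (`L_p`) for `E/ℚ` "is a theorem of
Amice–Vélu and Vishik (see [mtt])" (Prop. 1 [p0009 L60–L68]) — i.e. the Mazur–Tate–Teitelbaum
function.

## Transcription (`thm1_padicBSD_rankOne_multiplicative`)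

For `E/ℚ` with globally minimal model `W`, `p ≠ 2` a MULTIPLICATIVE prime, `ord_{s=1} L(E,s) = 1`
(`W.analyticRank = 1`), the newform `f` of `W` and `ϖ ∈ ℚ^×` with `ϖ · Ω_E = Ω⁺_f` — so that
`ϖ · L` is the Néron-period-normalised MTT function when `L` is THE `Ω⁺_f`-normalised one of the
tree (`IsMultPAdicLFunctionOf f p (-1) L` non-split, `IsSplitMultPAdicLFunctionOf f p L` split; both
unique, characterised by interpolation at all finite-order characters = Disegni's Hypothesis (`L_p`)
for `(E, Γ_ℚ)`) —, and THE canonical `p`-adic height datum of Stein–Wuthrich 2013 §4.2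
(`IsMultCanonical Dh q`: formula (4.1) = Schneider's / Mazur–Tate's height at a non-exceptional prime,
= Disegni's `h_ℓ` by Nekovář / Iovita–Werner [Compositio p0007 L48]; `IsSplitMultCanonical Dh Dq`:
the modified height `- log_p(u)²/log_p(q_E)` = Disegni's `h^{norm}` [p0008 L44]). The identity in
`Sym^{r̃} Γ_ℚ ⊗ ℚ_p ≅ ℚ_p` is read through the coordinate `ℓ₀ = log_p ∘ χ_cyc` (`ℓ₀(γ) = log_p γ_cyc`
for the tree's variable `T = γ - 1`, `γ_cyc = cyclotomicGenerator p`): `d^{r̃} L ↦ [T^{r̃}](ϖL) ·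
(log_p γ_cyc)^{r̃}`, `R̃_{ℓ₀} ↦ Reg_p(E, Dh)/#E(ℚ)_tors²` (Def. 1), `𝓛_{p,ℓ₀} ↦ log_p q_E/ord_p q_E =
LInvariant Dq` — exactly the `T`-variable shape of the tree's `PAdicBSDConjecture` /
`PAdicBSDConjectureExceptional` (Stein–Wuthrich 2013 §3; bsd.S24) with `#Ш` replaced by `#Ш_an = shaAn W`:
* non-split (`r̃ = 1`, `e_p(𝟙) = 1 - (-1) = 2`):
  `ϖ · [T¹]L · log_p γ_cyc · #E(ℚ)_tors² = u · 2 · #Ш_an · Reg_p(E,Dh) · ∏_v c_v`;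
* split, `p ≥ 5`, another multiplicative prime `m ≠ p` (`r̃ = 2`):
  `ϖ · [T²]L · (log_p γ_cyc)² · #E(ℚ)_tors² = u · 𝓛_p(E) · #Ш_an · Reg_p(E,Dh) · ∏_v c_v`;
in both cases together with `#Ш_an ∈ ℚ` (Hypothesis (BSD_∞)(2), part of the printed conclusion).

**Weaker than print, deliberately (never stronger):** (i) the identity is stated up to a `p`-adic
UNIT `u ∈ ℤ_pˣ` rather than exactly — this absorbs the sign/`2`-power conventions separating
Stein–Wuthrich's height normalisation, the real-component convention of the Néron period and the
Gauss-sum convention of the interpolation from Disegni's, none of which is re-derived here; (ii) hence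
`p ≠ 2` (at `p = 2` a factor `2` is not a unit; the source allows `p = 2` in the non-split clause);
(iii) only `r_an = 1` and `K = ℚ` (the printed theorem also covers `r_an = 0`, and Thm. 2 imaginary
quadratic base changes); (iv) the order-of-vanishing clause "at least `r̃`" is not transcribed (at a
multiplicative prime with `r_an = 1` it is the interpolation property). Every consumer in the cell
needs only valuations, for which (i) is immaterial.
-- TODO(general form): Thm. 1–2 ((BSD_p) relative form) for `A = E_K` over an imaginary quadratic `K`,
-- several variables (`Sym^{r̃} Γ_K`), `r_an = 0`, and the exact (unit-free) identity.

Design: hypotheses in the binder vocabulary of `Skinner2016.thmA_charIdeal_multiplicative` and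
`SteinWuthrich2013.thm61_{split,nonsplit}Multiplicative`, so that the three compose without glue
(`Summits/BirchSwinnertonDyer/Rank1Residual/X11b/ClassClosureDisegniLever.lean`). Mathlib (pin
v4.32.0) has no `p`-adic `L`-functions / heights; nothing duplicated.

References: [Disegni2020] Thm. 1 (§1.2), Thm. 4 (§3.2), (BSD_p) (§1.1.4), Def. 1 (§2.1),
Prop. 1–2 (§2.2, §3.1); D. Disegni, Compositio Math. 153 (2017) 1987–2074, Thm. B
(arXiv:1510.02114); [MazurTateTeitelbaum1986Invent] §II.10; [SteinWuthrich2013] §3, §4.2, Thm. 6.1;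
R. Venerucci, Invent. Math. 203 (2016) (the split case, up to `ℚ^×`).
-/

set_option autoImplicit false

noncomputable section

open scoped Classical MatrixGroups ModularForm

open CongruenceSubgroup WeierstrassCurve Literature.NumberTheory.EllipticCurves
  Literature.NumberTheory.EllipticCurves.ModularForms
  Literature.NumberTheory.EllipticCurves.SteinWuthrich2013

namespace Literature.NumberTheory.EllipticCurves.Disegni2020

/-- **Disegni 2020, Theorem 1 (= Thm. 4) at a multiplicative prime in analytic rank one: the
Mazur–Tate–Teitelbaum `p`-adic BSD leading-term formula HOLDS RELATIVE to the classical one, i.e.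
with `#Ш` replaced by the analytic order `#Ш_an` — a THEOREM of the cited paper.** As printed
(Kyoto J. Math. 60 (2020), Thm. 1, §1.2): "Let `E/ℚ` be an elliptic curve of conductor `N` with
ordinary reduction at the prime `p`. Suppose that `r_an := ord_{s=1} L(E,s) ≤ 1` and that (∗) if
`r_an = 1` and `S_p^{exc}(E) ≠ ∅`, then `p ≥ 5` and there exists another prime `m ≠ p` of
multiplicative reduction for `E`. Then Hypotheses (`L_p`) and (BSD_∞)(1)–(2) are satisfied, and
[the statement] (BSD_p) holds", (BSD_p) being the identity
"`d^{r̃} L_p(A,𝟙) = ∏_{𝔭∣p} ẽ_𝔭(𝟙) · R̃_ℓ(A) · |Ш(A)|_an · ∏_v c_v(A)` in `Sym^{r̃} Γ ⊗ L`"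
(§1.1.4) with `|Ш(A)|_an = L^{(r)}(A,1)/(r!·R_NT(A)·Ω_A·∏ c_v) ∈ ℚ^×` and regulators divided by
`|A(K)_tors|²` (Def. 1); Thm. 4 (§3.2), split case: "`d² L_p(E,𝟙) = 𝓛_p(E) · R^{norm}(E) ·
L'_alg(E,1)` in `Γ_ℚ^{⊗2} ⊗ ℚ`" — PROVED there (the author's `p`-adic Gross–Zagier formula,
Compositio 2017 Thm. B, with Yuan–Zhang–Zhang; Venerucci 2016 in the split case). Transcription
(module docstring) for a globally minimal `W`, a multiplicative prime `p ≠ 2`, `W.analyticRank = 1`,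
the newform `f`, `ϖ ≠ 0` with `ϖ · Ω_E = Ω⁺_f`, in the `T`-variable of the tree (`T = γ_cyc - 1`,
`log_p γ_cyc = padicLog p (cyclotomicGenerator p)`), up to a `p`-adic unit `u`, with
`#Ш_an = shaAn W` rational:
* NON-SPLIT `p` (Tate parameter `q`: `q ≠ 0`, `‖q‖ < 1`, `j(q) = j(E)`; THE MTT function
  `IsMultPAdicLFunctionOf f p (-1) L`; THE §4.2 height `IsMultCanonical Dh q`):
  `ϖ · [T¹]L · log_p γ_cyc · #E(ℚ)_tors² = u · (2 · (#Ш_an · Reg_p(E,Dh) · ∏_v c_v))`;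
* SPLIT `p ≥ 5` with a second multiplicative prime `m ≠ p` (Tate datum `Dq`; THE MTT function
  `IsSplitMultPAdicLFunctionOf f p L`; THE modified §4.2 height `IsSplitMultCanonical Dh Dq`):
  `ϖ · [T²]L · (log_p γ_cyc)² · #E(ℚ)_tors² = u · (𝓛_p(E) · (#Ш_an · Reg_p(E,Dh) · ∏_v c_v))`.
Weaker than the printed exact identity (unit `u`, `p ≠ 2`, `r_an = 1`, `K = ℚ` only — see the
module docstring); a published theorem, nothing asserted here. Inputs of the printed proof: the
author's `p`-adic Gross–Zagier formula (Compositio 2017, Thm. B), Yuan–Zhang–Zhang, Venerucci 2016,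
the Mazur–Tate–Teitelbaum function — none in Mathlib or the tree as theorems.
HEIGHT IDENTIFICATION (reading flag `Dis20-height-identification-reading`, REFEREE R133.2 (ii); the
pages re-read by this seat, 2026-08-21): Disegni's `R̃_ℓ` / `R^{norm}` IS the regulator of THE
Stein–Wuthrich §4.2 datum used below — (a) Disegni, Compositio Math. 153 (2017) §1.3.1
[arXiv:1510.02114 p0007 L48]: "If `χ` is not exceptional …, then [the pairing] is known to coincide
with the norm-adapted height pairings à la Schneider [schneider, nekheights], by [nekheights], and
with the Mazur–Tate [MT] height pairings, by [iovita-werner]"; (b) Disegni 2020 §1.1.3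
[arXiv:1609.02528 p0004 L64–L77]: `R̃_ℓ(A)` is the discriminant of the extended pairing, which "(a)
extends the 'canonical' height pairing `h_ℓ = h_ℓ^can` … also defined in [nekheights]; (b) in the
case `K = ℚ` considered in [mtt], our regulator `R̃_ℓ(A)` differs from the regulator of [mtt] by a
factor `ord_p(q_{A,p})` if `S_p^exc = {p}` (whereas the two coincide if `S_p^exc = ∅`)"; (c) ibid.
§2.1 [p0008 L8–L13, L40–L45]: "our notation and conventions are fixed as in [nekheights]" and "the
norm-adapted `h_ℓ^norm` (following Schneider [schneider]) … `h^norm_ℓ(x,y) = h_ℓ(x,y) −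
Σ_{𝔭 ∈ S_p^exc} log_{A,𝔭,ℓ}(x) log_{A,𝔭,ℓ}(y)/ℓ(q_{A,𝔭})`". So at a NON-SPLIT multiplicative `p`
(`S_p^exc = ∅`) Disegni's regulator = Mazur–Tate's = Schneider's = SW (4.1) (`IsMultCanonical`), and
at a SPLIT `p` Thm. 4's `R^{norm}` is SW (4.1) minus `log_p(u)²/log_p(q_E)` (`IsSplitMultCanonical`);
the residual `2`-power / sign / `ord_p(q)` conventions are inside the unit `u` (weakening (i)).
[cite: Disegni2017, §1.3.1 (arXiv:1510.02114 p0007 L48) (height identification: Nekovář = Schneider norm-adapted = Mazur–Tate at non-exceptional characters)]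
[cite: Disegni2020, §1.1.3 (a)–(b) (arXiv:1609.02528 p0004 L64–L77) and §2.1 (p0008 L8–L13, L40–L45) (regulator conventions)]
[cite: Disegni2020, Thm. 1 (§1.2) = Thm. 4 (§3.2); statement (BSD_p) §1.1.4; Def. 1 §2.1; Prop. 2 §3.1 (arXiv:1609.02528 numbering)] -/
def thm1_padicBSD_rankOne_multiplicative : Prop :=
  ∀ (W : WeierstrassCurve ℚ) [W.IsElliptic] [W.IsGloballyMinimal] (p : ℕ) [Fact p.Prime]
    {N : ℕ} [NeZero N] {f : CuspForm (Gamma0 N) 2},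
    p ≠ 2 → W.HasMultiplicativeReductionAtPrime p → W.analyticRank = 1 → IsNewformOf W f →
    ∀ (ϖ : ℚ), ϖ ≠ 0 → (ϖ : ℝ) * W.realPeriodRat = plusPeriod f →
      -- non-split clause (any odd `p`)
      (¬ W.HasSplitMultiplicativeReductionAtPrime p →
        ∀ (q : ℚ_[p]), q ≠ 0 → ‖q‖ < 1 → tateJ q = (W.j : ℚ_[p]) →
        ∀ (L : PowerSeries ℚ_[p]), IsMultPAdicLFunctionOf f p (-1) L →
        ∀ (Dh : PAdicHeightData W p), IsMultCanonical Dh q →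
          ∃ (s : ℚ) (u : ℤ_[p]ˣ), shaAn W = (s : ℂ) ∧
            ((ϖ : ℚ) : ℚ_[p]) * PowerSeries.coeff 1 L * padicLog p (cyclotomicGenerator p) *
                (W.torsionOrder : ℚ_[p]) ^ 2 =
              ((u : ℤ_[p]) : ℚ_[p]) * (2 * ((s : ℚ_[p]) * padicRegulator Dh * W.tamagawaProduct))) ∧
      -- split clause (`p ≥ 5` and a second multiplicative prime, hypothesis (∗))
      (W.HasSplitMultiplicativeReductionAtPrime p → 5 ≤ p →
        (∃ (m : ℕ) (_ : Fact m.Prime), m ≠ p ∧ W.HasMultiplicativeReductionAtPrime m) →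
        ∀ (Dq : TateParameterData W p) (L : PowerSeries ℚ_[p]), IsSplitMultPAdicLFunctionOf f p L →
        ∀ (Dh : PAdicHeightData W p), IsSplitMultCanonical Dh Dq →
          ∃ (s : ℚ) (u : ℤ_[p]ˣ), shaAn W = (s : ℂ) ∧
            ((ϖ : ℚ) : ℚ_[p]) * PowerSeries.coeff 2 L * padicLog p (cyclotomicGenerator p) ^ 2 *
                (W.torsionOrder : ℚ_[p]) ^ 2 =
              ((u : ℤ_[p]) : ℚ_[p]) *
                (LInvariant Dq * ((s : ℚ_[p]) * padicRegulator Dh * W.tamagawaProduct)))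

/-! ### Projections of the fact -/

namespace thm1_padicBSD_rankOne_multiplicative

/-- The NON-SPLIT clause of Thm. 1 at a multiplicative prime in analytic rank one (any odd `p`):
`ϖ · [T¹]L · log_p γ_cyc · #E(ℚ)_tors² = u · 2 · #Ш_an · Reg_p(E,Dh) · ∏ c_v` for THE MTT function
and THE §4.2 height. Projection of the fact (the fact is the explicit argument `hD`).
[cite: Disegni2020, Thm. 1 (§1.2) and Thm. 4 first bullet (§3.2)] -/
theorem nonsplit (hD : thm1_padicBSD_rankOne_multiplicative)
    (W : WeierstrassCurve ℚ) [W.IsElliptic] [W.IsGloballyMinimal] (p : ℕ) [Fact p.Prime]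
    {N : ℕ} [NeZero N] {f : CuspForm (Gamma0 N) 2}
    (hp : p ≠ 2) (hmult : W.HasMultiplicativeReductionAtPrime p) (hr : W.analyticRank = 1)
    (hf : IsNewformOf W f) (ϖ : ℚ) (hϖ0 : ϖ ≠ 0) (hϖ : (ϖ : ℝ) * W.realPeriodRat = plusPeriod f)
    (hns : ¬ W.HasSplitMultiplicativeReductionAtPrime p)
    {q : ℚ_[p]} (hq0 : q ≠ 0) (hq1 : ‖q‖ < 1) (hqj : tateJ q = (W.j : ℚ_[p]))
    (L : PowerSeries ℚ_[p]) (hL : IsMultPAdicLFunctionOf f p (-1) L)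
    (Dh : PAdicHeightData W p) (hDh : IsMultCanonical Dh q) :
    ∃ (s : ℚ) (u : ℤ_[p]ˣ), shaAn W = (s : ℂ) ∧
      ((ϖ : ℚ) : ℚ_[p]) * PowerSeries.coeff 1 L * padicLog p (cyclotomicGenerator p) *
          (W.torsionOrder : ℚ_[p]) ^ 2 =
        ((u : ℤ_[p]) : ℚ_[p]) * (2 * ((s : ℚ_[p]) * padicRegulator Dh * W.tamagawaProduct)) :=
  (hD W p hp hmult hr hf ϖ hϖ0 hϖ).1 hns q hq0 hq1 hqj L hL Dh hDh

/-- The SPLIT clause of Thm. 1 (hypothesis (∗): `p ≥ 5` and a second multiplicative prime):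
`ϖ · [T²]L · (log_p γ_cyc)² · #E(ℚ)_tors² = u · 𝓛_p(E) · #Ш_an · Reg_p(E,Dh) · ∏ c_v`. Projection
of the fact (explicit argument `hD`). [cite: Disegni2020, Thm. 1 (§1.2) and Thm. 4 second bullet (§3.2)] -/
theorem split (hD : thm1_padicBSD_rankOne_multiplicative)
    (W : WeierstrassCurve ℚ) [W.IsElliptic] [W.IsGloballyMinimal] (p : ℕ) [Fact p.Prime]
    {N : ℕ} [NeZero N] {f : CuspForm (Gamma0 N) 2}
    (hp : p ≠ 2) (hmult : W.HasMultiplicativeReductionAtPrime p) (hr : W.analyticRank = 1)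
    (hf : IsNewformOf W f) (ϖ : ℚ) (hϖ0 : ϖ ≠ 0) (hϖ : (ϖ : ℝ) * W.realPeriodRat = plusPeriod f)
    (hsplit : W.HasSplitMultiplicativeReductionAtPrime p) (hp5 : 5 ≤ p)
    (hm : ∃ (m : ℕ) (_ : Fact m.Prime), m ≠ p ∧ W.HasMultiplicativeReductionAtPrime m)
    (Dq : TateParameterData W p) (L : PowerSeries ℚ_[p]) (hL : IsSplitMultPAdicLFunctionOf f p L)
    (Dh : PAdicHeightData W p) (hDh : IsSplitMultCanonical Dh Dq) :
    ∃ (s : ℚ) (u : ℤ_[p]ˣ), shaAn W = (s : ℂ) ∧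
      ((ϖ : ℚ) : ℚ_[p]) * PowerSeries.coeff 2 L * padicLog p (cyclotomicGenerator p) ^ 2 *
          (W.torsionOrder : ℚ_[p]) ^ 2 =
        ((u : ℤ_[p]) : ℚ_[p]) * (LInvariant Dq * ((s : ℚ_[p]) * padicRegulator Dh * W.tamagawaProduct)) :=
  (hD W p hp hmult hr hf ϖ hϖ0 hϖ).2 hsplit hp5 hm Dq L hL Dh hDh

end thm1_padicBSD_rankOne_multiplicative

end Literature.NumberTheory.EllipticCurves.Disegni2020

end
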